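import Literature.Barriers.RiemannHypothesis.GramRosserFailuresProofs
import Literature.NumberTheory.LFunctions.HardyZSignParity
import Literature.NumberTheory.LFunctions.SelbergArgOmega
import HarnessLib

/-!
# Lehman's argument: Rosser's rule fails beyond every height, from Selberg's `Ω`-theorem

Sibling of `Literature/Barriers/RiemannHypothesis/GramRosserFailures.lean`, which vendors
Trudgian's Theorem 7.3 (*Acta Arith.* 148 (2011), pp. 250–251; "based on the argument of
Lehman [22]") as the named fact `Literature.Barriers.RiemannHypothesis.TrudgianGram2011_thm7_3`:
there is no `T₀` beyond which every Gram block satisfies the Weak Rosser Rule. This file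
**proves** that fact, and Titchmarsh's "infinitely many bad Gram points"
(`Literature.Barriers.RiemannHypothesis.Titchmarsh1935_badGramPoints`), hence the whole barrier
`GramRosserFailures`, *from the single analytic input actually used in the printed proof*:
"`S(t)` is ultimately bounded below, which contradicts the theorem of Selberg given in (41)" —
i.e. from the unboundedness of `S = Literature.NumberTheory.LFunctions.zetaArgS` from below on
half-lines, a proved consequence (`Selberg1946_zetaArgS_omega.unbounded_below`, file
`SelbergArgOmega.lean`) of the named fact `Literature.NumberTheory.LFunctions.Selberg1946_zetaArgS_omega`
(Selberg 1946, Trudgian eq. (41)), which remains the only undischarged hypothesis: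

* `TrudgianGram2011_thm7_3_of_zetaArgS_unbounded_below`, `TrudgianGram2011_thm7_3_of_selberg`;
* `Titchmarsh1935_badGramPoints_of_zetaArgS_unbounded_below`;
* `GramRosserFailures_of_selberg`.

## The printed proof and the repair of one step

Trudgian (proof of Thm. 7.3): suppose the Weak Rosser Rule holds in every Gram block
`(g_n, g_{n+k}]` with `g_n > T₀`. By Backlund's `N(T) = θ(T)/π + 1 + S(T)` (here the *definition*
of `zetaArgS`) and `θ(g_n) = nπ`, `S(g_{n+k}) − S(g_n) = N(g_{n+k}) − N(g_n) − k ≥ 0`, so (56)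
`S` does not decrease along good Gram points; "let `g_m` and `g_{m+1}` be consecutive bad Gram
points … there must be at least one zero in this interval", so (57) `S(g_{m+1}) ≥ S(g_m)`; hence
`S(g_ν) ≥ S(T₀) − 1` at all Gram points and `S(t) ≥ S(T₀) − 2` for `t > T₀`, contradicting (41).
Step (57) as printed has a gap when `Z` vanishes exactly at a bad Gram point `g_m` and not at
`g_{m+1}`: the forced zero may be `g_m` itself, which is not in `(g_m, g_{m+1}]`. The repair
(`criticalZeroCount_add_le_of_bad_run`) counts with multiplicity using the parity lemma
`Literature.NumberTheory.LFunctions.hardyZ_sign_parity` (`(−1)^{N₀(a)+N₀(b)} Z(a) Z(b) > 0`):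
between consecutive *non-vanishing* bad Gram points `g_u`, `g_j` all intermediate Gram points are
zeros of `Z`, giving `j − u − 1` zeros, and the signs `(−1)^{u+1}`, `(−1)^{j+1}` of `Z(g_u)`,
`Z(g_j)` force the parity of `N₀(g_j) − N₀(g_u)` to be that of `j − u`, whence
`N₀(g_j) − N₀(g_u) ≥ j − u`. The outcome is `N₀(g_j) − N₀(g_a) ≥ (j − a) − 2` along any run of
Gram points whose interior points are bad, `≥ (j − a)` across a Gram block (the Weak Rosser Rule),
so `N₀(g_j) − N₀(g_{a₀}) ≥ (j − a₀) − 4` for all `j ≥ a₀` (`g_{a₀} ≥ T₀`), and with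
`N − N₀` non-decreasing (`criticalZeroCount_sub_le_zetaZeroCount_sub`) and `θ` increasing,
`S(t) ≥ N(g_{a₀}) − a₀ − 6` for all `t ≥ g_{a₀}`. No separate input "there are infinitely many
good Gram points" is needed. The same bookkeeping with all Gram points good from some index on
gives Titchmarsh's theorem from the same input.

Gram points enter only through a sequence `g` with `IsGramPoint n (g n)` for all `n` (it exists
and is unique, `Edwards1974_gramPoint_existsUnique_holds`; it is strictly increasing and unbounded
since `θ` is strictly increasing on `[7, ∞)`).

## References

* T. Trudgian, *On the success and failure of Gram's Law and the Rosser Rule*, Acta Arith. 148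
  (2011), 225–256: Defs. 7.1–7.2, Thm. 7.3 and its proof (pp. 250–251), eq. (41) (p. 241), §4.3.
* R. S. Lehman, *On the distribution of zeros of the Riemann zeta-function*, Proc. LMS (3) 20
  (1970), 303–320 (the argument; as cited by Trudgian).
* H. M. Edwards, *Riemann's Zeta Function* (1974), §6.5 (Gram points), §8.4 (Rosser's rule and
  the note added in the second printing on Lehman 1970).
* A. Selberg, *Contributions to the theory of the Riemann zeta-function*, Arch. Math. Naturvid.
  48 (1946), no. 5, 89–155 (the `Ω`-theorem; named fact).
-/

noncomputable section

open Filter Set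
open scoped Real Topology

namespace Literature.Barriers.RiemannHypothesis

open Literature.NumberTheory.LFunctions

/-! ### Sequences of Gram points -/

section GramSeq

variable {g : ℕ → ℝ}

/-- Gram points increase strictly with the index (`θ(g_m) = mπ < nπ = θ(g_n)` and `θ` is strictly
increasing on `[7, ∞)`). [cite: Edwards1974, §6.5] -/
theorem strictMono_of_isGramPoint (hg : ∀ n, IsGramPoint n (g n)) : StrictMono g := by
  intro m n hmn
  have hθ : riemannSiegelTheta (g m) < riemannSiegelTheta (g n) := by
    rw [(hg m).2, (hg n).2]
    exact mul_lt_mul_of_pos_right (by exact_mod_cast hmn) Real.pi_pos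
  exact (strictMonoOn_riemannSiegelTheta_Ici_seven.lt_iff_lt
    (show (7 : ℝ) ≤ g m by linarith [(hg m).1]) (show (7 : ℝ) ≤ g n by linarith [(hg n).1])).1 hθ

/-- Beyond every height there is a Gram point (`θ → ∞` is not even needed: `θ(g_n) = nπ`).
[cite: Edwards1974, §6.5] -/
theorem exists_le_gramPoint (hg : ∀ n, IsGramPoint n (g n)) (T : ℝ) : ∃ n : ℕ, T ≤ g n := by
  obtain ⟨n, hn⟩ := exists_nat_gt (riemannSiegelTheta (max T 7) / π)
  refine ⟨n, (le_max_left T 7).trans ?_⟩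
  have hθ : riemannSiegelTheta (max T 7) < riemannSiegelTheta (g n) := by
    rw [(hg n).2]
    rwa [div_lt_iff₀ Real.pi_pos] at hn
  exact ((strictMonoOn_riemannSiegelTheta_Ici_seven.lt_iff_lt (le_max_right T 7)
    (show (7 : ℝ) ≤ g n by linarith [(hg n).1])).1 hθ).le

/-- **Backlund at a Gram point** (Trudgian Thm. 4.1 at `T = g_n`): `S(g_n) = N(g_n) − n − 1`,
since `θ(g_n) = nπ` (for the tree's `S := N − θ/π − 1` this is immediate).
[cite: TrudgianGram2011, Thm. 4.1] -/
theorem zetaArgS_gramPoint (hg : ∀ n, IsGramPoint n (g n)) (n : ℕ) :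
    zetaArgS (g n) = zetaZeroCount (g n) - n - 1 := by
  rw [zetaArgS, (hg n).2, mul_div_cancel_right₀ _ Real.pi_ne_zero]

/-- **Vanishing Gram points are zeros**: if `Z(g_i) = 0` for the indices `i` of a finite set
`S ⊆ (u, j]`, then `N₀(g_u) + |S| ≤ N₀(g_j)`. [folklore] -/
theorem criticalZeroCount_add_card_le_of_gramPoint (hg : ∀ n, IsGramPoint n (g n)) {u j : ℕ}
    (huj : u ≤ j) (S : Finset ℕ) (hS : ∀ i ∈ S, u < i ∧ i ≤ j ∧ hardyZ (g i) = 0) :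
    criticalZeroCount (g u) + S.card ≤ criticalZeroCount (g j) := by
  classical
  have hmono := strictMono_of_isGramPoint hg
  have h := criticalZeroCount_add_card_le (a := g u) (b := g j) (by linarith [(hg u).1])
    (hmono.monotone huj) (S.image g) ?_
  · rwa [Finset.card_image_of_injective _ hmono.injective] at h
  · intro γ hγ
    rw [Finset.mem_image] at hγ
    obtain ⟨i, hi, rfl⟩ := hγ
    obtain ⟨hui, hij, hz⟩ := hS i hi
    exact ⟨(hardyZ_eq_zero_iff_holds _).1 hz, hmono hui, hmono.monotone hij⟩

/-- **Parity between Gram points**, oriented form: for `u ≤ j` with `Z(g_u), Z(g_j) ≠ 0`,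
`(−1)^{N₀(g_u) + N₀(g_j) + u + j} · ((−1)^u Z(g_u)) · ((−1)^j Z(g_j)) > 0`
(`hardyZ_sign_parity` with `Z(g_u) Z(g_j) = (−1)^{u+j} ((−1)^u Z(g_u)) ((−1)^j Z(g_j))`).
[folklore] -/
theorem gramPoint_parity (hg : ∀ n, IsGramPoint n (g n)) {u j : ℕ} (huj : u ≤ j)
    (hu : hardyZ (g u) ≠ 0) (hj : hardyZ (g j) ≠ 0) :
    0 < (-1 : ℝ) ^ (criticalZeroCount (g u) + criticalZeroCount (g j) + u + j) *
      ((-1) ^ u * hardyZ (g u) * ((-1) ^ j * hardyZ (g j))) := by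
  have h := hardyZ_sign_parity (by linarith [(hg u).1])
    ((strictMono_of_isGramPoint hg).monotone huj) hu hj
  have e : (-1 : ℝ) ^ (criticalZeroCount (g u) + criticalZeroCount (g j) + u + j) *
      ((-1) ^ u * hardyZ (g u) * ((-1) ^ j * hardyZ (g j))) =
      (-1 : ℝ) ^ (criticalZeroCount (g u) + criticalZeroCount (g j)) * (hardyZ (g u) * hardyZ (g j)) *
        (((-1) ^ u) ^ 2 * ((-1) ^ j) ^ 2) := by
    ring
  rw [e]
  exact mul_pos h (mul_pos (sq_pos_of_ne_zero (pow_ne_zero _ (by norm_num)))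
    (sq_pos_of_ne_zero (pow_ne_zero _ (by norm_num))))

/-- At a bad Gram point where `Z` does not vanish, `(−1)^n Z(g_n) < 0`. [cite: TrudgianGram2011, §7.2] -/
theorem neg_one_pow_mul_hardyZ_neg_of_not_isGoodGram {n : ℕ} {x : ℝ} (hbad : ¬ IsGoodGram n x)
    (hne : hardyZ x ≠ 0) : (-1 : ℝ) ^ n * hardyZ x < 0 :=
  lt_of_le_of_ne (not_lt.1 hbad) (mul_ne_zero (pow_ne_zero _ (by norm_num)) hne)

/-! ### Lehman's bookkeeping along runs of bad Gram points -/

/-- **Deficit at most one along a run of bad Gram points ending at a bad point.** If all Gram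
points `g_i`, `a < i < j`, are bad and `g_j` is bad (or `j = a`), then
`N₀(g_j) − N₀(g_a) ≥ (j − a) − 1`. (Strong induction on `j`: let `g_u` be the last Gram point
before `g_j` in the run at which `Z ≠ 0`; the Gram points strictly between `g_u` and `g_j` are
zeros of `Z`, and when `Z(g_j) ≠ 0` the parity lemma upgrades the count by one because
`(−1)^u Z(g_u) < 0` and `(−1)^j Z(g_j) < 0`.) This is the repaired form of Trudgian's (57).
[cite: TrudgianGram2011, Thm. 7.3 (proof, (57))] -/
theorem criticalZeroCount_add_le_of_bad_run (hg : ∀ n, IsGramPoint n (g n)) (a : ℕ) :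
    ∀ j : ℕ, a ≤ j → (∀ i, a < i → i < j → ¬ IsGoodGram i (g i)) →
      (¬ IsGoodGram j (g j) ∨ j = a) →
      criticalZeroCount (g a) + j ≤ criticalZeroCount (g j) + a + 1 := by
  intro j
  induction j using Nat.strong_induction_on with
  | _ j ih =>
  intro haj hbad hend
  rcases hend with hjbad | rfl
  swap
  · omega
  rcases haj.eq_or_lt with rfl | haj'
  · omega
  classical
  -- the non-vanishing indices in `[a, j)`
  set W : Finset ℕ := (Finset.Ico a j).filter (fun i ↦ hardyZ (g i) ≠ 0) with hW
  rcases W.eq_empty_or_nonempty with hWe | hWne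
  · -- every Gram point `g_i`, `a ≤ i < j`, is a zero of `Z`: count those with `a < i < j`
    have hcount := criticalZeroCount_add_card_le_of_gramPoint hg haj (Finset.Ioo a j)
      (fun i hi ↦ by
        rw [Finset.mem_Ioo] at hi
        refine ⟨hi.1, hi.2.le, ?_⟩
        by_contra hne
        have hiW : i ∈ W := by
          simp only [hW, Finset.mem_filter, Finset.mem_Ico]
          exact ⟨⟨hi.1.le, hi.2⟩, hne⟩
        rw [hWe] at hiW
        simp at hiW)
    rw [Nat.card_Ioo] at hcount
    omega
  · set u : ℕ := W.max' hWne with hu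
    have huW : u ∈ W := W.max'_mem hWne
    simp only [hW, Finset.mem_filter, Finset.mem_Ico] at huW
    obtain ⟨⟨hau, huj⟩, hZu⟩ := huW
    have hvan : ∀ i, u < i → i < j → hardyZ (g i) = 0 := by
      intro i hui hij
      by_contra hne
      have hiW : i ∈ W := by
        simp only [hW, Finset.mem_filter, Finset.mem_Ico]
        exact ⟨⟨by omega, hij⟩, hne⟩
      have := W.le_max' i hiW
      omega
    rcases hau.eq_or_lt with hau' | hau'
    · -- `u = a`: the Gram points strictly between `g_a` and `g_j` are zeros
      have hcount := criticalZeroCount_add_card_le_of_gramPoint hg haj (Finset.Ioo a j)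
        (fun i hi ↦ by
          rw [Finset.mem_Ioo] at hi
          exact ⟨hi.1, hi.2.le, hvan i (hau' ▸ hi.1) hi.2⟩)
      rw [Nat.card_Ioo] at hcount
      omega
    · -- `a < u < j`: `g_u` is bad with `Z(g_u) ≠ 0`
      have hubad : ¬ IsGoodGram u (g u) := hbad u hau' huj
      have hIH := ih u huj hau (fun i hai hiu ↦ hbad i hai (hiu.trans huj)) (Or.inl hubad)
      by_cases hZj : hardyZ (g j) = 0
      · have hcount := criticalZeroCount_add_card_le_of_gramPoint hg huj.le (Finset.Ioc u j)
          (fun i hi ↦ by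
            rw [Finset.mem_Ioc] at hi
            refine ⟨hi.1, hi.2, ?_⟩
            rcases hi.2.eq_or_lt with rfl | hlt
            · exact hZj
            · exact hvan i hi.1 hlt)
        rw [Nat.card_Ioc] at hcount
        omega
      · have hcount := criticalZeroCount_add_card_le_of_gramPoint hg huj.le (Finset.Ioo u j)
          (fun i hi ↦ by
            rw [Finset.mem_Ioo] at hi
            exact ⟨hi.1, hi.2.le, hvan i hi.1 hi.2⟩)
        rw [Nat.card_Ioo] at hcount
        have hpar := gramPoint_parity hg huj.le hZu hZj
        have hσu := neg_one_pow_mul_hardyZ_neg_of_not_isGoodGram hubad hZu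
        have hσj := neg_one_pow_mul_hardyZ_neg_of_not_isGoodGram hjbad hZj
        have heven := even_of_neg_one_pow_mul_pos (mul_pos_of_neg_of_neg hσu hσj) hpar
        rw [Nat.even_iff] at heven
        omega

/-- **Deficit at most two along a run whose interior Gram points are bad** (the end point may be
good): `N₀(g_j) − N₀(g_a) ≥ (j − a) − 2`. [cite: TrudgianGram2011, Thm. 7.3 (proof)] -/
theorem criticalZeroCount_add_le_of_bad_interior (hg : ∀ n, IsGramPoint n (g n)) {a j : ℕ}
    (haj : a ≤ j) (hbad : ∀ i, a < i → i < j → ¬ IsGoodGram i (g i)) :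
    criticalZeroCount (g a) + j ≤ criticalZeroCount (g j) + a + 2 := by
  rcases haj.eq_or_lt with rfl | hlt
  · omega
  · obtain ⟨k, rfl⟩ : ∃ k, j = k + 1 := ⟨j - 1, by omega⟩
    have hk : a ≤ k := by omega
    have hA := criticalZeroCount_add_le_of_bad_run hg a k hk
      (fun i hai hik ↦ hbad i hai (by omega)) (by
        rcases hk.eq_or_lt with rfl | hlt'
        · exact Or.inr rfl
        · exact Or.inl (hbad k hlt' (by omega)))
    have hmono := criticalZeroCount_mono
      ((strictMono_of_isGramPoint hg).monotone (Nat.le_add_right k 1))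
    omega

/-! ### Across Gram blocks: the Weak Rosser Rule -/

/-- **`S` does not decrease along good Gram points** (Trudgian (56)), in the form: if the Weak
Rosser Rule holds in every Gram block `(g_n, g_{n+l}]` with `g_n ≥ T₀`, and `g_{a₀} ≥ T₀`, then
`N₀(g_c) − N₀(g_{a₀}) ≥ (c − a₀) − 2` at every good Gram point `g_c`, `c ≥ a₀` (induction over the
good Gram points: consecutive ones bound a Gram block). [cite: TrudgianGram2011, Thm. 7.3 (proof, (56))] -/
theorem criticalZeroCount_add_le_of_isGoodGram (hg : ∀ n, IsGramPoint n (g n)) {T₀ : ℝ} {a₀ : ℕ}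
    (ha₀ : T₀ ≤ g a₀) (H : ∀ n l, IsGramBlock n l g → T₀ ≤ g n → WeakRosserRule n l g) :
    ∀ c : ℕ, a₀ ≤ c → IsGoodGram c (g c) →
      criticalZeroCount (g a₀) + c ≤ criticalZeroCount (g c) + a₀ + 2 := by
  intro c
  induction c using Nat.strong_induction_on with
  | _ c ih =>
  intro hac hgood
  classical
  -- the good indices in `[a₀, c)`
  set W : Finset ℕ := (Finset.Ico a₀ c).filter (fun i ↦ IsGoodGram i (g i)) with hW
  rcases W.eq_empty_or_nonempty with hWe | hWne
  · refine criticalZeroCount_add_le_of_bad_interior hg hac fun i hai hic hgi ↦ ?_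
    have hiW : i ∈ W := by
      simp only [hW, Finset.mem_filter, Finset.mem_Ico]
      exact ⟨⟨hai.le, hic⟩, hgi⟩
    rw [hWe] at hiW
    simp at hiW
  · set c' : ℕ := W.max' hWne with hc'
    have hc'W : c' ∈ W := W.max'_mem hWne
    simp only [hW, Finset.mem_filter, Finset.mem_Ico] at hc'W
    obtain ⟨⟨hac', hc'c⟩, hgood'⟩ := hc'W
    have hbad : ∀ i, c' < i → i < c → ¬ IsGoodGram i (g i) := by
      intro i h1 h2 hgi
      have hiW : i ∈ W := by
        simp only [hW, Finset.mem_filter, Finset.mem_Ico]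
        exact ⟨⟨by omega, h2⟩, hgi⟩
      have := W.le_max' i hiW
      omega
    -- the Gram block `(g_{c'}, g_c]`
    have hcc' : c' + (c - c') = c := Nat.add_sub_cancel' hc'c.le
    have hblock : IsGramBlock c' (c - c') g := by
      refine ⟨by omega, fun j _ _ ↦ hg j, hgood', ?_, fun j h1 h2 ↦ hbad j h1 (by omega)⟩
      rw [hcc']
      exact hgood
    have hW' : c - c' + criticalZeroCount (g c') ≤ criticalZeroCount (g (c' + (c - c'))) :=
      H c' (c - c') hblock (ha₀.trans ((strictMono_of_isGramPoint hg).monotone hac'))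
    rw [hcc'] at hW'
    have hIH := ih c' hc'c hac' hgood'
    omega

/-- **The master count.** Under the same hypothesis, `N₀(g_j) − N₀(g_{a₀}) ≥ (j − a₀) − 4` for
*every* `j ≥ a₀` (Trudgian: "`S(g_ν) ≥ S(T₀) − 1` for all Gram points"; the constant is immaterial).
[cite: TrudgianGram2011, Thm. 7.3 (proof)] -/
theorem criticalZeroCount_add_le_of_weakRosser (hg : ∀ n, IsGramPoint n (g n)) {T₀ : ℝ}
    {a₀ : ℕ} (ha₀ : T₀ ≤ g a₀)
    (H : ∀ n l, IsGramBlock n l g → T₀ ≤ g n → WeakRosserRule n l g) {j : ℕ} (haj : a₀ ≤ j) :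
    criticalZeroCount (g a₀) + j ≤ criticalZeroCount (g j) + a₀ + 4 := by
  classical
  by_cases hgood : IsGoodGram j (g j)
  · have := criticalZeroCount_add_le_of_isGoodGram hg ha₀ H j haj hgood
    omega
  set W : Finset ℕ := (Finset.Ico a₀ j).filter (fun i ↦ IsGoodGram i (g i)) with hW
  rcases W.eq_empty_or_nonempty with hWe | hWne
  · have := criticalZeroCount_add_le_of_bad_run hg a₀ j haj (fun i hai hij hgi ↦ by
      have hiW : i ∈ W := by
        simp only [hW, Finset.mem_filter, Finset.mem_Ico]
        exact ⟨⟨hai.le, hij⟩, hgi⟩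
      rw [hWe] at hiW
      simp at hiW) (Or.inl hgood)
    omega
  · set c' : ℕ := W.max' hWne with hc'
    have hc'W : c' ∈ W := W.max'_mem hWne
    simp only [hW, Finset.mem_filter, Finset.mem_Ico] at hc'W
    obtain ⟨⟨hac', hc'j⟩, hgood'⟩ := hc'W
    have hbad : ∀ i, c' < i → i < j → ¬ IsGoodGram i (g i) := by
      intro i h1 h2 hgi
      have hiW : i ∈ W := by
        simp only [hW, Finset.mem_filter, Finset.mem_Ico]
        exact ⟨⟨by omega, h2⟩, hgi⟩
      have := W.le_max' i hiW
      omega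
    have h1 := criticalZeroCount_add_le_of_bad_run hg c' j hc'j.le hbad (Or.inl hgood)
    have h2 := criticalZeroCount_add_le_of_isGoodGram hg ha₀ H c' hac' hgood'
    omega

/-- **`S` is bounded below beyond `g_{a₀}`** under the eventual Weak Rosser Rule:
`S(t) ≥ N(g_{a₀}) − a₀ − 6` for `t ≥ g_{a₀}` (Trudgian: "`S(t) ≥ S(T₀) − 2` for all `t > T₀`").
Ingredients: the master count, `N − N₀` non-decreasing, `N` non-decreasing, and
`θ(t) < θ(g_{j+1}) = (j+1)π` on `[g_j, g_{j+1})`. [cite: TrudgianGram2011, Thm. 7.3 (proof)] -/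
theorem zetaArgS_ge_of_weakRosser (hg : ∀ n, IsGramPoint n (g n)) {T₀ : ℝ} {a₀ : ℕ}
    (ha₀ : T₀ ≤ g a₀) (H : ∀ n l, IsGramBlock n l g → T₀ ≤ g n → WeakRosserRule n l g)
    {t : ℝ} (ht : g a₀ ≤ t) :
    (zetaZeroCount (g a₀) : ℝ) - a₀ - 6 ≤ zetaArgS t := by
  classical
  have hmono := strictMono_of_isGramPoint hg
  -- locate `t` in `[g_j, g_{j+1})`
  have hex : ∃ j : ℕ, t < g (j + 1) := by
    obtain ⟨n, hn⟩ := exists_le_gramPoint hg (t + 1)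
    exact ⟨n, by linarith [hmono.monotone (Nat.le_add_right n 1)]⟩
  set j := Nat.find hex with hj
  have hj1 : t < g (j + 1) := Nat.find_spec hex
  have hj0 : g j ≤ t := by
    rcases Nat.eq_zero_or_pos j with h0 | hpos
    · rw [h0]
      exact (hmono.monotone (Nat.zero_le a₀)).trans ht
    · have hmin := Nat.find_min hex (show j - 1 < j by omega)
      rw [show j - 1 + 1 = j by omega, not_lt] at hmin
      exact hmin
  have haj : a₀ ≤ j := by
    by_contra hlt
    push Not at hlt
    have := hmono.monotone (show j + 1 ≤ a₀ by omega)
    linarith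
  -- counts
  have hchain := criticalZeroCount_add_le_of_weakRosser hg ha₀ H haj
  have hNN := criticalZeroCount_sub_le_zetaZeroCount_sub (hmono.monotone haj)
  have hNt : zetaZeroCount (g j) ≤ zetaZeroCount t := zetaZeroCount_mono hj0
  -- `θ(t) < (j + 1) π`
  have hθ : riemannSiegelTheta t < ((j + 1 : ℕ) : ℝ) * π := by
    rw [← (hg (j + 1)).2]
    exact strictMonoOn_riemannSiegelTheta_Ici_seven (show (7 : ℝ) ≤ t by linarith [(hg j).1])
      (show (7 : ℝ) ≤ g (j + 1) by linarith [(hg (j + 1)).1]) hj1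
  have hθ' : riemannSiegelTheta t / π < j + 1 := by
    rw [div_lt_iff₀ Real.pi_pos]
    push_cast at hθ
    linarith
  have h1 : (criticalZeroCount (g a₀) : ℝ) + j ≤ criticalZeroCount (g j) + a₀ + 4 := by
    exact_mod_cast hchain
  have h2 : (criticalZeroCount (g j) : ℝ) - criticalZeroCount (g a₀) ≤
      (zetaZeroCount (g j) : ℝ) - zetaZeroCount (g a₀) := by
    exact_mod_cast hNN
  have h3 : (zetaZeroCount (g j) : ℝ) ≤ zetaZeroCount t := by exact_mod_cast hNt
  rw [zetaArgS]
  linarith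

end GramSeq

/-! ### Theorem 7.3 and the barrier, from Selberg's theorem -/

/-- A sequence of Gram points exists (`Edwards1974_gramPoint_existsUnique_holds`). [cite: Edwards1974, §6.5] -/
theorem exists_gramPoint_seq : ∃ g : ℕ → ℝ, ∀ n, IsGramPoint n (g n) :=
  ⟨fun n ↦ (Edwards1974_gramPoint_existsUnique_holds n).exists.choose,
    fun n ↦ (Edwards1974_gramPoint_existsUnique_holds n).exists.choose_spec⟩

/-- **Trudgian 2011, Theorem 7.3 (Lehman 1970), from the unboundedness of `S` from below.** If
`S(t)` is unbounded below on every half-line (Selberg, Trudgian eq. (41)), then there is no `T₀`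
beyond which every Gram block satisfies the Weak Rosser Rule: otherwise
`S(t) ≥ N(g_{a₀}) − a₀ − 6` for all `t ≥ g_{a₀}` (`zetaArgS_ge_of_weakRosser`), a contradiction.
[cite: TrudgianGram2011, Thm. 7.3] -/
theorem TrudgianGram2011_thm7_3_of_zetaArgS_unbounded_below
    (hS : ∀ C T : ℝ, ∃ t : ℝ, T ≤ t ∧ zetaArgS t < C) : TrudgianGram2011_thm7_3 := by
  rintro ⟨T₀, H⟩
  obtain ⟨g, hg⟩ := exists_gramPoint_seq
  obtain ⟨a₀, ha₀⟩ := exists_le_gramPoint hg T₀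
  obtain ⟨t, ht, hSt⟩ := hS ((zetaZeroCount (g a₀) : ℝ) - a₀ - 6) (g a₀)
  have := zetaArgS_ge_of_weakRosser hg ha₀ (fun n l hb hT ↦ H n l g hb hT) ht
  linarith

/-- **Trudgian 2011, Theorem 7.3, conditional on Selberg's `Ω`-theorem** (the named fact
`Literature.NumberTheory.LFunctions.Selberg1946_zetaArgS_omega`, Trudgian eq. (41)) — exactly the
dependence of the printed proof. [cite: TrudgianGram2011, Thm. 7.3] -/
theorem TrudgianGram2011_thm7_3_of_selberg (h : Selberg1946_zetaArgS_omega) :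
    TrudgianGram2011_thm7_3 :=
  TrudgianGram2011_thm7_3_of_zetaArgS_unbounded_below h.unbounded_below

/-- **Titchmarsh 1935 from the unboundedness of `S` from below.** If `S(t)` is unbounded below
on every half-line then infinitely many Gram points are bad: if all `g_n`, `n ≥ M`, were good,
consecutive ones would bound Gram blocks of length `1`, in which the Weak Rosser Rule holds
automatically (`Z(g_n) Z(g_{n+1}) < 0` forces an odd number of zeros in `(g_n, g_{n+1}]`, by the
parity lemma), so `S` would be bounded below beyond `g_M`. (Titchmarsh's and Trudgian's §4.3 route
is via Bohr–Landau under finitely many exceptions to RH; the present route uses Selberg's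
unconditional theorem instead, as Trudgian's footnote 6 suggests for Thm. 7.3.)
[cite: TrudgianGram2011, §4.3] -/
theorem Titchmarsh1935_badGramPoints_of_zetaArgS_unbounded_below
    (hS : ∀ C T : ℝ, ∃ t : ℝ, T ≤ t ∧ zetaArgS t < C) : Titchmarsh1935_badGramPoints := by
  obtain ⟨g, hg⟩ := exists_gramPoint_seq
  have hmono := strictMono_of_isGramPoint hg
  by_contra hfin
  rw [Titchmarsh1935_badGramPoints, Set.not_infinite] at hfin
  -- beyond some index `M`, every Gram point is good
  obtain ⟨M, hM⟩ : ∃ M : ℕ, ∀ n, M ≤ n → IsGoodGram n (g n) := by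
    obtain ⟨M, hM⟩ := hfin.bddAbove
    refine ⟨M + 1, fun n hn ↦ ?_⟩
    by_contra hbad
    have : n ∈ {n : ℕ | ∃ g : ℝ, IsGramPoint n g ∧ ¬ IsGoodGram n g} := ⟨g n, hg n, hbad⟩
    have := hM this
    omega
  -- every Gram block beyond `g_M` has length one and obeys the Weak Rosser Rule
  have H : ∀ n l, IsGramBlock n l g → g M ≤ g n → WeakRosserRule n l g := by
    rintro n l ⟨hl, -, hgoodn, hgoodnl, hint⟩ hMn
    have hMn' : M ≤ n := hmono.le_iff_le.1 hMn
    have hl1 : l = 1 := by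
      by_contra hl1
      exact hint (n + 1) (by omega) (by omega) (hM (n + 1) (by omega))
    subst hl1
    -- `(−1)^n Z(g_n) > 0` and `(−1)^{n+1} Z(g_{n+1}) > 0`: an odd number of zeros in between
    have hZn : hardyZ (g n) ≠ 0 := fun h0 ↦ by simp [IsGoodGram, h0] at hgoodn
    have hZn1 : hardyZ (g (n + 1)) ≠ 0 := fun h0 ↦ by simp [IsGoodGram, h0] at hgoodnl
    have hpar := gramPoint_parity hg (Nat.le_add_right n 1) hZn hZn1
    have heven := even_of_neg_one_pow_mul_pos (mul_pos hgoodn hgoodnl) hpar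
    rw [Nat.even_iff] at heven
    change 1 + criticalZeroCount (g n) ≤ criticalZeroCount (g (n + 1))
    have hmono' := criticalZeroCount_mono (hmono.monotone (Nat.le_add_right n 1))
    omega
  obtain ⟨t, ht, hSt⟩ := hS ((zetaZeroCount (g M) : ℝ) - M - 6) (g M)
  have := zetaArgS_ge_of_weakRosser hg le_rfl H ht
  linarith

/-- **The barrier `GramRosserFailures` from Selberg's `Ω`-theorem alone**: both conjuncts —
infinitely many bad Gram points (Titchmarsh 1935) and the failure of the Weak Rosser Rule beyond
every height (Lehman 1970; Trudgian Thm. 7.3) — follow from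
`Literature.NumberTheory.LFunctions.Selberg1946_zetaArgS_omega`, which is thereby the barrier's
whole trust base. [cite: TrudgianGram2011, §4.3 and Thm. 7.3] -/
theorem GramRosserFailures_of_selberg (h : Selberg1946_zetaArgS_omega) : GramRosserFailures :=
  GramRosserFailures_of (Titchmarsh1935_badGramPoints_of_zetaArgS_unbounded_below h.unbounded_below)
    (TrudgianGram2011_thm7_3_of_selberg h)

end Literature.Barriers.RiemannHypothesis
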